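import Summits.CriticalPhenomena.Ising3DConformalLimit.Theorems.IsingEuclidUpgradeIsingEuclidUpgradeR2RotInvPowerLawRayProfiles
import Summits.CriticalPhenomena.Ising3DConformalLimit.Theses.BallOrbitComparison
import HarnessLib

/-!
# Crux `IsingEuclidUpgradeR2RotInvPowerLaw` (stmt-CriticalPhenomena-0634), line `tower_profile_rigidity`:
# the KARAMATA LINK — item 5047 (`TwoPointRegularVariation`) gives S2 and D2, and feeds the glue T1 → S2 → A_rays → r2

Write `G := criticalTwoPoint 3` for the critical two-point function `⟨σ₀σ_x⟩_{β_c}` of the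
nearest-neighbour Ising model on `ℤ³` and `g(n) := G(n e₀)` for its axis values. Item
stmt-CriticalPhenomena-5047 (`Theses.BallOrbitComparison.TwoPointRegularVariation`) says that the
canonical renormalisation `ρ_c(δ) := g(⌊δ⁻¹⌋)^{-1/2}` is regularly varying at `0⁺` in Karamata form:
there is `Δ > 0` with `ρ_c(cδ)/ρ_c(δ) → c^{-Δ}` as `δ → 0⁺`, for every `c > 0`.

**Theorem** (`integerDilationLawAt_of_regularVariationAt`). If `ρ_c(cδ)/ρ_c(δ) → c^{-Δ}` at `0⁺` for
every `c > 0`, then the axis sequence obeys the integer dilation law S2 at the SAME `Δ`: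
`g(kn)k^{2Δ}/g(n) → 1` for every integer `k ≥ 1`.

Proof. Fix `k ≥ 1` and read the hypothesis at `c := 1/k` along `δ_n := 1/n → 0⁺`: since
`⌊δ_n⁻¹⌋ = n` and `⌊(cδ_n)⁻¹⌋ = kn` exactly, `ρ_c(cδ_n)/ρ_c(δ_n) = √g(n)/√g(kn) → (1/k)^{-Δ} = k^Δ`.
Squaring (`g > 0`), `g(n)/g(kn) → k^{2Δ}`; inverting and multiplying by the constant `k^{2Δ}`,
`g(kn)k^{2Δ}/g(n) → k^{2Δ}·k^{-2Δ} = 1`. ∎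

**Corollaries** (registered names, statements verbatim).
* `integerDilationLaw_of_twoPointRegularVariation`: item 5047 ⇒ `∃ Δ, S2 at Δ`.
* `dyadicScalingLaw_of_twoPointRegularVariation`: item 5047 ⇒ D2 (item stmt-CriticalPhenomena-6323,
  `g(2n)4^Δ/g(n) → 1` with `Δ > 0`): `k = 2` and `4^Δ = 2^{2Δ}`, with the `Δ > 0` of item 5047.
* `IsingEuclidUpgradeR2RotInvPowerLaw_of_towerLaw_of_twoPointRegularVariation_of_rayProfiles`:
  `T1 → item 5047 → A_rays → r2`, by the landed glue
  `IsingEuclidUpgradeR2RotInvPowerLaw_of_towerLaw_of_dilationLaw_of_rayProfiles` fed with S2.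

References: H. Duminil-Copin, ICM 2022, §8.1 (the pure power law / rotation invariance of the critical
two-point function on `ℤ³` is postulated there, not proved) [DuminilCopinICM2022]; reading the
Karamata form of regular variation along the integer dilations `δ = 1/n`, `c = 1/k` is elementary.
No definitions are introduced; item 5047 enters only as a hypothesis.
-/

noncomputable section

namespace Summit.CriticalPhenomena.Ising3DConformalLimit.Cruxes.IsingEuclidUpgradeR2RotInvPowerLaw.TowerProfileRigidity

open Filter Topology Literature.Probability.LatticeModels

/-! ### Karamata at `c = 1/k` along `δ = 1/n`: S2 at the same exponent -/

/-- **Regular variation of `ρ_c` in Karamata form ⇒ the integer dilation law S2, same exponent.**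
If `ρ_c(cδ)/ρ_c(δ) → c^{-Δ}` as `δ → 0⁺` for every `c > 0`, where
`ρ_c(δ) = ⟨σ₀σ_{⌊δ⁻¹⌋e₀}⟩_{β_c(3)}^{-1/2}` (the shape of item stmt-CriticalPhenomena-5047 at a given
exponent `Δ`), then `⟨σ₀σ_{kne₀}⟩_{β_c}k^{2Δ}/⟨σ₀σ_{ne₀}⟩_{β_c} → 1` for every integer `k ≥ 1`:
evaluate at `c = 1/k` along `δ_n = 1/n` (the floors are exact), square, invert.
[cite: DuminilCopinICM2022, §8.1] -/
theorem integerDilationLawAt_of_regularVariationAt {Δ : ℝ}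
    (hrv : ∀ c : ℝ, 0 < c → Tendsto
      (fun δ : ℝ => 1 / Real.sqrt (criticalTwoPoint 3 (Pi.single 0 ⌊(c * δ)⁻¹⌋)) /
        (1 / Real.sqrt (criticalTwoPoint 3 (Pi.single 0 ⌊δ⁻¹⌋))))
      (𝓝[>] (0 : ℝ)) (𝓝 (c ^ (-Δ))))
    (k : ℕ) (hk : 1 ≤ k) :
    Tendsto (fun n : ℕ => criticalTwoPoint 3 (Pi.single 0 ((k * n : ℕ) : ℤ)) * (k : ℝ) ^ (2 * Δ) /
      criticalTwoPoint 3 (Pi.single 0 ((n : ℕ) : ℤ))) atTop (𝓝 1) := by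
  have hk0 : (0 : ℝ) < k := by exact_mod_cast hk
  have hgpos : ∀ m : ℕ, 0 < criticalTwoPoint 3 (Pi.single 0 ((m : ℕ) : ℤ)) := fun m =>
    Literature.Probability.LatticeModels.criticalTwoPoint_axis_pos m
  -- the sequence `δ_n := 1/n → 0⁺`
  have hu : Tendsto (fun n : ℕ => ((n : ℝ))⁻¹) atTop (𝓝[>] (0 : ℝ)) := by
    refine tendsto_nhdsWithin_iff.2 ⟨tendsto_inv_atTop_nhds_zero_nat, ?_⟩
    filter_upwards [eventually_ge_atTop 1] with n hn
    have hn' : (0 : ℝ) < n := by exact_mod_cast hn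
    exact inv_pos.2 hn'
  -- step 1: the hypothesis at `c = 1/k` along `δ_n`: `√g(n)/√g(kn) → (1/k)^{-Δ} = k^Δ`
  have h1 : Tendsto (fun n : ℕ => Real.sqrt (criticalTwoPoint 3 (Pi.single 0 ((n : ℕ) : ℤ))) /
      Real.sqrt (criticalTwoPoint 3 (Pi.single 0 ((k * n : ℕ) : ℤ)))) atTop (𝓝 ((k : ℝ) ^ Δ)) := by
    have h := (hrv (k : ℝ)⁻¹ (inv_pos.2 hk0)).comp hu
    have hval : ((k : ℝ)⁻¹) ^ (-Δ) = (k : ℝ) ^ Δ := by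
      rw [Real.rpow_neg (inv_nonneg.2 hk0.le), Real.inv_rpow hk0.le, inv_inv]
    rw [hval] at h
    refine h.congr fun n => ?_
    have e1 : ((k : ℝ)⁻¹ * ((n : ℝ))⁻¹)⁻¹ = ((k * n : ℕ) : ℝ) := by
      rw [mul_inv_rev, inv_inv, inv_inv, Nat.cast_mul, mul_comm]
    simp only [Function.comp_apply]
    rw [e1, inv_inv, Int.floor_natCast, Int.floor_natCast, one_div, one_div, inv_div_inv]
  -- step 2: square it: `g(n)/g(kn) → k^{2Δ}`
  have h2 : Tendsto (fun n : ℕ => criticalTwoPoint 3 (Pi.single 0 ((n : ℕ) : ℤ)) /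
      criticalTwoPoint 3 (Pi.single 0 ((k * n : ℕ) : ℤ))) atTop (𝓝 ((k : ℝ) ^ (2 * Δ))) := by
    have h := h1.pow 2
    have hval : ((k : ℝ) ^ Δ) ^ 2 = (k : ℝ) ^ (2 * Δ) := by
      rw [mul_comm, Real.rpow_mul hk0.le, Real.rpow_two]
    rw [hval] at h
    refine h.congr fun n => ?_
    rw [div_pow, Real.sq_sqrt (hgpos n).le, Real.sq_sqrt (hgpos (k * n)).le]
  -- step 3: invert and multiply by the constant `k^{2Δ}`
  have hK : (0 : ℝ) < (k : ℝ) ^ (2 * Δ) := Real.rpow_pos_of_pos hk0 _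
  have h3 := (h2.inv₀ hK.ne').const_mul ((k : ℝ) ^ (2 * Δ))
  rw [mul_inv_cancel₀ hK.ne'] at h3
  refine h3.congr fun n => ?_
  rw [inv_div]
  ring

/-! ### The registered links: item 5047 ⇒ S2, item 5047 ⇒ D2 (item 6323), and T1 ∧ 5047 ∧ A_rays ⇒ r2 -/

/-- **KARAMATA LINK, S2 (registered name `integerDilationLaw_of_twoPointRegularVariation`, verbatim).**
Item stmt-CriticalPhenomena-5047 (`TwoPointRegularVariation`: `ρ_c(cδ)/ρ_c(δ) → c^{-Δ}` at `0⁺` for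
some `Δ > 0` and every `c > 0`, `ρ_c(δ) = ⟨σ₀σ_{⌊δ⁻¹⌋e₀}⟩_{β_c(3)}^{-1/2}`) implies the integer dilation
law S2 of the critical axis two-point sequence, `⟨σ₀σ_{kne₀}⟩_{β_c}k^{2Δ}/⟨σ₀σ_{ne₀}⟩_{β_c} → 1` for
every `k ≥ 1`, at the exponent `Δ` of item 5047 (`integerDilationLawAt_of_regularVariationAt`).
[cite: DuminilCopinICM2022, §8.1] -/
theorem integerDilationLaw_of_twoPointRegularVariation : Summit.CriticalPhenomena.Ising3DConformalLimit.Theses.BallOrbitComparison.TwoPointRegularVariation → ∃ Δ : ℝ, ∀ k : ℕ, 1 ≤ k → Filter.Tendsto (fun n : ℕ => Literature.Probability.LatticeModels.criticalTwoPoint 3 (Pi.single 0 ((k * n : ℕ) : ℤ)) * (k : ℝ) ^ (2 * Δ) / Literature.Probability.LatticeModels.criticalTwoPoint 3 (Pi.single 0 ((n : ℕ) : ℤ))) Filter.atTop (nhds 1) := by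
  rintro ⟨Δ, -, hrv⟩
  exact ⟨Δ, integerDilationLawAt_of_regularVariationAt hrv⟩

/-- **KARAMATA LINK, D2 (registered name `dyadicScalingLaw_of_twoPointRegularVariation`, verbatim).**
Item stmt-CriticalPhenomena-5047 (`TwoPointRegularVariation`) implies the dyadic scaling law D2 of
item stmt-CriticalPhenomena-6323 with a positive exponent: `⟨σ₀σ_{2ne₀}⟩_{β_c}4^{Δ}/⟨σ₀σ_{ne₀}⟩_{β_c} → 1`
for the `Δ > 0` of item 5047 — the case `k = 2` of S2 at `Δ`
(`integerDilationLawAt_of_regularVariationAt`), since `2^{2Δ} = 4^Δ`. [cite: DuminilCopinICM2022, §8.1] -/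
theorem dyadicScalingLaw_of_twoPointRegularVariation : Summit.CriticalPhenomena.Ising3DConformalLimit.Theses.BallOrbitComparison.TwoPointRegularVariation → ∃ Δ : ℝ, 0 < Δ ∧ Filter.Tendsto (fun n : ℕ => Literature.Probability.LatticeModels.criticalTwoPoint 3 (Pi.single 0 ((2 * n : ℕ) : ℤ)) * (4 : ℝ) ^ Δ / Literature.Probability.LatticeModels.criticalTwoPoint 3 (Pi.single 0 ((n : ℕ) : ℤ))) Filter.atTop (nhds 1) := by
  rintro ⟨Δ, hΔ, hrv⟩
  refine ⟨Δ, hΔ, ?_⟩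
  have h4 : ((2 : ℕ) : ℝ) ^ (2 * Δ) = (4 : ℝ) ^ Δ := by
    rw [Nat.cast_ofNat, Real.rpow_mul (by norm_num : (0 : ℝ) ≤ 2), Real.rpow_two]
    norm_num
  have h2 := integerDilationLawAt_of_regularVariationAt hrv 2 (by norm_num)
  rw [h4] at h2
  exact h2

/-- **TOWER × KARAMATA × RAY-PROFILES glue (registered name
`IsingEuclidUpgradeR2RotInvPowerLaw_of_towerLaw_of_twoPointRegularVariation_of_rayProfiles`, verbatim):
T1 → item 5047 → A_rays → r2.** Item stmt-CriticalPhenomena-5047 supplies S2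
(`integerDilationLaw_of_twoPointRegularVariation`); with the dyadic tower law T1 and the ray profiles
A_rays, the landed glue `IsingEuclidUpgradeR2RotInvPowerLaw_of_towerLaw_of_dilationLaw_of_rayProfiles`
concludes the route decl by name. [cite: DuminilCopinICM2022, §8.1] -/
theorem IsingEuclidUpgradeR2RotInvPowerLaw_of_towerLaw_of_twoPointRegularVariation_of_rayProfiles : (∃ Δ c : ℝ, 0 < c ∧ Filter.Tendsto (fun j : ℕ => Literature.Probability.LatticeModels.criticalTwoPoint 3 (Pi.single 0 ((2 ^ j : ℕ) : ℤ)) * ((2 ^ j : ℕ) : ℝ) ^ (2 * Δ)) Filter.atTop (nhds c)) → Summit.CriticalPhenomena.Ising3DConformalLimit.Theses.BallOrbitComparison.TwoPointRegularVariation → (∀ v : Literature.Probability.LatticeModels.Site 3, v ≠ 0 → ∃ c : ℝ, 0 < c ∧ Filter.Tendsto (fun n : ℕ => Literature.Probability.LatticeModels.criticalTwoPoint 3 (((n : ℕ) : ℤ) • v) / Literature.Probability.LatticeModels.criticalTwoPoint 3 (Pi.single 0 ((⌊(n : ℝ) * Real.sqrt (∑ i, ((v i : ℝ)) ^ 2)⌋₊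 : ℕ) : ℤ))) Filter.atTop (nhds c)) → Summit.CriticalPhenomena.Ising3DConformalLimit.Theses.IsingEuclidUpgrade.IsingEuclidUpgradeR2RotInvPowerLaw :=
  fun hT hRV hA => IsingEuclidUpgradeR2RotInvPowerLaw_of_towerLaw_of_dilationLaw_of_rayProfiles hT
    (integerDilationLaw_of_twoPointRegularVariation hRV) hA

end Summit.CriticalPhenomena.Ising3DConformalLimit.Cruxes.IsingEuclidUpgradeR2RotInvPowerLaw.TowerProfileRigidity

end
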